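import Summits.CriticalPhenomena.SAWScalingLimit.Theorems.SAWDevelopingMapNoFoldBoundOfInputs
import Summits.CriticalPhenomena.SAWScalingLimit.Theorems.SAWDevelopingMapNoFoldBoundRawDominance

/-!
# Skeleton — crux `NoFoldBound` (stmt-CriticalPhenomena-8296), line `Ideator3Sketch` (lead c10, v11 re-registered unchanged)

STATUS (v11, registered by lead seat c5, re-registered unchanged by lead seats c6, c7, c8, c9 and c10: the four stubs are the complete list of
conjecture-grade inputs of this line; see `Lines/Ideator3Sketch.md`, sections Lead c6 / c7 / c8, for the terminal assessment). The composition is now a TREE theorem: `noFoldBound_of_inputs` (OfInputs p124749)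
proves `NoFoldBound` from the four named inputs of v10 and the sibling crux (M) `InteriorFlattening`; this file only
instantiates it. Reshape of this seat: the two middle-port dominance inputs are stated in RAW first-arrival masses
`N_w = Σ_{γ : a → {v,w}, v ∉ γ} x_c^ℓ` (pure critical-SAW statements, no parafermionic dressing) — `stub_rawDominance`,
`stub_rawDominanceSrc` — and turned into the dressed hypotheses of `noFold_collarTwo` by the landed glue
`dom_of_rawDominance`, `domSrc_of_rawDominanceSrc` (RawDominance p124748: dressed ≤ α_T·raw since loop sums ≥ 0, and
the middle port's dressed mass = α_T·raw because its slit-loop type is empty, `middle_port_no_slit_loop` p122978 /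
`isEmpty_slitLoop_to_src`). NECESSITY (new, landed): `noStarvation_of_noFoldBound` (NoStarvation p124943, with
`three_class_necessary` ThreeClassNec p124690) — `NoFoldBound` itself forces, at every depth-2 vertex with all
neighbours inside, `2·min(s_outer) ≤ 3·s_mid + max(s_outer)` for the dressed masses (raw form
`8·min(N_outer) ≤ 15·N_mid + 5·max(N_outer)`, RawNoStarvation): a Harnack-type lower bound for the middle port in the
balanced regime is part of the crux on EVERY line, exactly as the rooted-loop constant is (`sourceLoopBound_of_noFoldBound`
p88850). History: v10 (lead c4: `noFold_collarTwo`, chain rigidity, middle loops), v7 (c3: depth-2 stratum), v5 (c1/c2: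
sealed stratum, DCS-LP barrier), v4 (leads 0/−1: boundary layer, `NoFoldBound ↔ SourceLoopBound ∧ SlitCoherence`).

The `sorry`s (all conjecture-grade named inputs; nothing else is open on this line):
* `stub_slitLoopFifth` — the returning-loop series of `SourceLoopBound` with the constant `1/5` (sup = 0.1175 ± 0.0015
  numerically; certified DCS-LP barrier `Theorems/NoFoldBound/Negative/BoundaryRay*.lean`);
* `stub_rawDominance`, `stub_rawDominanceSrc` — middle-port dominance of RAW first-arrival masses at depth-2 vertices
  (touching neighbour off the source / equal to the source vertex): `min(N_outer) ≤ N_mid`; exact enumeration min ratio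
  3.109 (≤ 79 vertices, 4.2e8 configurations exhaustive ≤ 15), Monte Carlo ≈ 2.6–2.7 (≤ 1630 vertices); necessary form
  `8·min ≤ 15·N_mid + 5·max` is a theorem; Harnack-type with a sharp constant, no tool in print;
* `stub_collarDepthThree` — slit coherence at interior vertices of depth ≥ 3 within distance `R` of the complement,
  for every `R` (finite rigid bands by `chain_rigidity` p122446; quantitative comparabilities inside the band needed).
-/

noncomputable section

open scoped BigOperators
open Literature.Probability.LatticeModels Literature.Probability.RandomPlanarGeometry.SAW

namespace Summit.CriticalPhenomena.SAWScalingLimit.Theorems.SAWDevelopingMapNoFoldBound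

/-! ## The named inputs (stubs) -/

/-- **Stub (quantitative slit-loop bound — open, conjecture-grade).** The returning-loop series of
`SourceLoopBound` (stmt-CriticalPhenomena-8300) with the explicit constant `1/5`: for every simply connected
`Λ`, `u ∉ Λ` adjacent to `v ∈ Λ` and the two other neighbours `w₁ ≠ w₂` of `v`, the critical series of
self-avoiding walks of `Λ ∖ {v}` from `{v,w₁}` to `{v,w₂}` is `≤ 1/5` (numerically `sup ≈ 0.13`; the
threshold of SourceLoopBound is `sin(π/8) = 0.383`; the depth-2 algebra needs the dressing box `r(c) ≤ 4/5`,
i.e. `c ≤ 0.205`). Stronger than the item stmt-8300 by the constant only; same (open) content. -/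
theorem stub_slitLoopFifth :
    ∀ (Λ : Finset HexVertex), hexDomainSimplyConnected Λ →
      ∀ u v w₁ w₂ : HexVertex, u ∉ Λ → v ∈ Λ → hexGraph.Adj v u → hexGraph.Adj v w₁ →
        hexGraph.Adj v w₂ → u ≠ w₁ → u ≠ w₂ → w₁ ≠ w₂ →
        (∑ γ : HexMidEdgeSAW (Λ.erase v) s(v, w₁) s(v, w₂), hexCriticalFugacity ^ γ.length) ≤ 1 / 5 := by
  sorry

/-- **Stub (middle-port dominance at depth 2, RAW first-arrival masses — open, conjecture-grade).** At an
interior vertex `v` off the source, for a positive labelling `(w₀, w₁, w₂)` (`w₀ → v → w₁` turns by `+π/3`) whose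
first neighbour `w₀ ∉ a` touches the complement (`w₀ ∼ x ∉ Λ`, third neighbour `y`), the first arrivals at `v`
occupy three consecutive rigid winding classes, one per port, the MIDDLE one being `w₁` if `y → w₀ → v` turns left
and `w₂` if it turns right (`depthTwo_core`); the stub asks that the raw first-arrival mass
`N_w = Σ_{γ : a → {v,w}, v ∉ γ} x_c^{ℓ(γ)}` of the middle port be at least the smaller of the two other ports'.
A Harnack-type comparability of critical-SAW first-arrival masses at three adjacent feeders near a rough boundary:
numerically min ratio 3.109 (exact, ≤ 79 vertices; exhaustive over all simply connected |Λ| ≤ 15), ≈ 2.6–2.7 at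
115–1630 vertices (Monte Carlo); the necessary form `8·min ≤ 15·N_mid + 5·max` follows from `NoFoldBound`
(`rawNoStarvation_of_noFoldBound`). Degenerate positions (a port vertex outside `Λ`) are included and hold by a
discrete Jordan argument resp. trivially. Implies the dressed form `stub_portDominance` of v10 (`dom_of_rawDominance`). -/
theorem stub_rawDominance :
    ∀ (Λ : Finset HexVertex), hexDomainSimplyConnected Λ → ∀ a ∈ hexDomainBoundary Λ,
      ∀ v ∈ Λ, v ∉ a → ∀ w₀ w₁ w₂ x y : HexVertex, hexGraph.Adj v w₀ → hexGraph.Adj v w₁ →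
      hexGraph.Adj v w₂ → w₀ ≠ w₁ → w₁ ≠ w₂ → w₀ ≠ w₂ → w₀ ∈ Λ → w₀ ∉ a →
      winding [hexMidpoint s(w₀, v), hexCenter v, hexMidpoint s(v, w₁)] = Real.pi / 3 →
      hexGraph.Adj w₀ x → hexGraph.Adj w₀ y → v ≠ x → x ≠ y → v ≠ y → x ∉ Λ →
      let N : HexVertex → ℝ := fun w =>
        ∑ γ : HexMidEdgeSAW Λ a s(v, w), if v ∉ γ.verts then hexCriticalFugacity ^ γ.length else 0
      (winding [hexMidpoint s(y, w₀), hexCenter w₀, hexMidpoint s(w₀, v)] = Real.pi / 3 →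
          min (N w₀) (N w₂) ≤ N w₁) ∧
        (winding [hexMidpoint s(y, w₀), hexCenter w₀, hexMidpoint s(w₀, v)] = -(Real.pi / 3) →
          min (N w₀) (N w₁) ≤ N w₂) := by
  sorry

/-- **Stub (middle-port dominance, RAW masses, source-adjacent position — open, conjecture-grade).** The statement
of `stub_rawDominance` with the touching neighbour `w₀` equal to the SOURCE VERTEX (`a = {x, w₀}`, `x ∉ Λ`, third
neighbour `y`); here `N_{w₀} = x_c` is the single trivial arrival. Numerically min ratio 5.6–8.3 (exact ≤ 36
vertices), 4.15 (Monte Carlo, 256–581 vertices), 0 violations. Implies `stub_portDominanceSrc` of v10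
(`domSrc_of_rawDominanceSrc`). -/
theorem stub_rawDominanceSrc :
    ∀ (Λ : Finset HexVertex), hexDomainSimplyConnected Λ → ∀ a ∈ hexDomainBoundary Λ,
      ∀ v ∈ Λ, v ∉ a → ∀ w₀ w₁ w₂ x y : HexVertex, hexGraph.Adj v w₀ → hexGraph.Adj v w₁ →
      hexGraph.Adj v w₂ → w₀ ≠ w₁ → w₁ ≠ w₂ → w₀ ≠ w₂ → w₀ ∈ Λ → a = s(x, w₀) →
      winding [hexMidpoint s(w₀, v), hexCenter v, hexMidpoint s(v, w₁)] = Real.pi / 3 →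
      hexGraph.Adj w₀ x → hexGraph.Adj w₀ y → v ≠ x → x ≠ y → v ≠ y → x ∉ Λ →
      let N : HexVertex → ℝ := fun w =>
        ∑ γ : HexMidEdgeSAW Λ a s(v, w), if v ∉ γ.verts then hexCriticalFugacity ^ γ.length else 0
      (winding [hexMidpoint s(y, w₀), hexCenter w₀, hexMidpoint s(w₀, v)] = Real.pi / 3 →
          min (N w₀) (N w₂) ≤ N w₁) ∧
        (winding [hexMidpoint s(y, w₀), hexCenter w₀, hexMidpoint s(w₀, v)] = -(Real.pi / 3) →
          min (N w₀) (N w₁) ≤ N w₂) := by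
  sorry

/-- **Stub (the collar at depth ≥ 3 — open).** Collar coherence (v6 form: for every radius `R` one `k_R < 1`
at the fed, unsealed interior vertices that are not `R`-deep), RESTRICTED to the vertices covered neither by the
depth-2 theorem nor by the source-adjacent theorem: no neighbour `w ∉ a` of `v` touches the complement AND no
neighbour of `v` is the source vertex — i.e. every second neighbour of `v` lies in `Λ` (depth ≥ 3). The first
arrivals are no longer rigid here (wrapped winding classes, 6–7 classes with geometric tails, three dominant
consecutive classes carrying ≥ 90 % of the mass in all depth-3 data); no criterion yet. -/
theorem stub_collarDepthThree :
    ∀ R : ℝ, ∃ k : ℝ, k < 1 ∧ ∀ (Λ : Finset HexVertex), hexDomainSimplyConnected Λ →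
      ∀ a ∈ hexDomainBoundary Λ, ∀ v ∈ Λ, v ∉ a → (∀ u : HexVertex, hexGraph.Adj v u → u ∈ Λ) →
      (∀ w : HexVertex, hexGraph.Adj v w → ∃ y : HexVertex, hexGraph.Adj w y ∧ y ≠ v ∧ y ∈ Λ) →
      (∃ w : HexVertex, dist (hexCenter w) (hexCenter v) ≤ R ∧ w ∉ Λ) →
      (¬ ∃ w x : HexVertex, hexGraph.Adj v w ∧ hexGraph.Adj w x ∧ x ≠ v ∧ x ∉ Λ ∧ w ∉ a) →
      (¬ ∃ w : HexVertex, hexGraph.Adj v w ∧ w ∈ a) →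
      ∀ w₀ w₁ w₂ : HexVertex, hexGraph.Adj v w₀ → hexGraph.Adj v w₁ → hexGraph.Adj v w₂ →
      w₀ ≠ w₁ → w₁ ≠ w₂ → w₀ ≠ w₂ →
      winding [hexMidpoint s(w₀, v), hexCenter v, hexMidpoint s(v, w₁)] = Real.pi / 3 →
      let x : ℝ := hexCriticalFugacity
      let α : ℝ := 1 + 2 * hexCriticalFugacity * Real.cos (5 * Real.pi / 24)
      let β : ℝ := 1 + 2 * hexCriticalFugacity * Real.cos (11 * Real.pi / 24)
      let ω : ℂ := Complex.exp (2 * Real.pi * Complex.I / 3)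
      let Z : (w p q : HexVertex) → HexMidEdgeSAW Λ a s(v, w) → ℝ :=
        fun w p q (γ : HexMidEdgeSAW Λ a s(v, w)) =>
        ∑ δ : HexMidEdgeSAW ((Λ \ γ.verts.toFinset).erase v) s(v, p) s(v, q), x ^ δ.length
      let B : (w p q : HexVertex) → ℂ := fun w p q =>
        ∑ γ : HexMidEdgeSAW Λ a s(v, w), if v ∉ γ.verts then
          γ.weight x (5 / 8) * ((β + Real.sqrt 3 * x * Z w p q γ : ℝ) : ℂ) else 0
      let S : (w p q : HexVertex) → ℂ := fun w p q =>
        ∑ γ : HexMidEdgeSAW Λ a s(v, w), if v ∉ γ.verts then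
          γ.weight x (5 / 8) * ((α - Real.sqrt 3 * x * Z w p q γ : ℝ) : ℂ) else 0
      ‖B w₀ w₁ w₂ + ω * B w₁ w₂ w₀ + ω ^ 2 * B w₂ w₀ w₁‖ ≤
        k * ‖S w₀ w₁ w₂ + S w₁ w₂ w₀ + S w₂ w₀ w₁‖ := by
  sorry

/-! ## Composition -/

/-- **The crux from the four named inputs and the sibling crux `InteriorFlattening` (stmt-8297)** — an instance of
the tree theorem `noFoldBound_of_inputs` (depth ≤ 2 → `noFold_collarTwo`; `R₀`-deep → (M); the rest →
`stub_collarDepthThree` through `interior_labellings_at`), with the dominance inputs supplied in raw form through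
`dom_of_rawDominance` / `domSrc_of_rawDominanceSrc`. -/
theorem NoFoldBound_of
    (hM : Summit.CriticalPhenomena.SAWScalingLimit.Theses.SAWDevelopingMap.InteriorFlattening) :
    Summit.CriticalPhenomena.SAWScalingLimit.Theses.SAWDevelopingMap.NoFoldBound :=
  noFoldBound_of_inputs stub_slitLoopFifth (dom_of_rawDominance stub_rawDominance)
    (domSrc_of_rawDominanceSrc stub_rawDominanceSrc) stub_collarDepthThree hM

end Summit.CriticalPhenomena.SAWScalingLimit.Theorems.SAWDevelopingMapNoFoldBound

end
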